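import Mathlib.Analysis.SpecificLimits.Basic
import HarnessLib

/-!
# Far-edge descent, kernel XXXIX-J — linear towers of the β-dial do not amplify (model level)

Kernels XXXIX-H/I showed that SQUARING towers of the β-dial (kernel XXXVIII) are floor-inconsistent
at finite depth for every `β < 2`.  The other extreme schedule, the LINEAR tower `O_{k+1} = O_k ⊗ B`
(a fresh base at every step, the Coppersmith–Winograd shape), replenishes narrow legs and is NOT
excluded by the floors — but it does not amplify either.  In the dial's exact coordinates
(`u'' = u + u' − 3uu'`, `F'' = F·F' + a(3−a)·u·u'`, normal form `F = 1 − a·u + X` with deviation `X`;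
`a = 3(β−1)/(2β−1) ∈ (0,1]`, shares `u ≤ 1/3`) the product identity gives, for a deep factor `(u, X)`
times the base `(u_B, X_B)`,
`X'' = X·(1 − a·u_B) + X_B·(1 − a·u) + X·X_B`
(`deviation_linear_step`) — a CONTRACTION plus a bounded source, whereas squaring gives
`X'' = 2(1 − a·u)X + X²`, the multiplier `2(3−a)/3 > 1` of kernel XXXVIII.  Hence along a linear tower
the deviation stays bounded (`linear_tower_bounded`: `X_k ≤ max(X_0, X_B/(a·u_B − X_B))` when the
base's own deviation is small, `X_B < a·u_B`) while `ℓ_k = ℓ_0 + k·ℓ_B → ∞`: exponent `0`, no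
amplification at all.  Together with H/I: in the floor-constrained dial, amplification lives only in
MIXED schedules (some deep × deep products, paid for with base steps) — quantified numerically in memo
NODE-g59 §4, where every schedule tried stays below the `β = 2` corner's order `θ_S = 0.7095`.

HONEST FRAMING: statements about the MODEL's real recursions only; nothing about tensors, `ω(1,k,1)`
or `AnchoredLogConvexity`.  No definitions.

References: kernel XXXVIII (`dial_product_step`); Coppersmith–Winograd 1982 (the linear tower shape)
[CoppersmithWinograd1982]; Landsberg–Ottaviani 2015, Thm. 1.1 [LandsbergOttaviani2015] (the floors,
via XXXIX-G, that leave linear towers alive).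
-/

noncomputable section

set_option linter.dupNamespace false

namespace Summit.MatrixMultiplication.MatrixMultiplication.Theorems.FarEdgeDescentDialLinearTower

/-- **The deviation after one base step.**  With `F = 1 − a u + X`, `F_B = 1 − a u_B + X_B`,
`F'' = F·F_B + a(3−a)·u·u_B` and `u'' = u + u_B − 3·u·u_B`:
`F'' − (1 − a u'') = X(1 − a u_B) + X_B(1 − a u) + X·X_B`. -/
theorem deviation_linear_step (a u uB X XB : ℝ) :
    (1 - a * u + X) * (1 - a * uB + XB) + a * (3 - a) * u * uB - (1 - a * (u + uB - 3 * u * uB)) =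
      X * (1 - a * uB) + XB * (1 - a * u) + X * XB := by
  ring

/-- For contrast, **the deviation after squaring**: `F'' − (1 − a u'') = 2(1 − a u)·X + X²`
(multiplier `2(1 − a u) ≥ 2(3 − a)/3 > 1` on the window `u ≤ 1/3`, kernel XXXVIII). -/
theorem deviation_square_step (a u X : ℝ) :
    (1 - a * u + X) * (1 - a * u + X) + a * (3 - a) * u * u - (1 - a * (u + u - 3 * u * u)) =
      2 * (1 - a * u) * X + X ^ 2 := by
  ring

/-- **Linear towers do not amplify.**  Along `O_{k+1} = O_k ⊗ B` with the dial's exact recursions,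
shares in the window (`0 ≤ a·u_k`), a base with `a·u_B ≤ 1` and small deviation
`0 ≤ X_B < a·u_B`, the deviation `X_k = F_k − (1 − a·u_k)` is bounded uniformly in `k`:
`X_k ≤ max (X_0) (X_B/(a·u_B − X_B))`. -/
theorem linear_tower_bounded {a uB FB : ℝ} (u F : ℕ → ℝ) (haU1 : a * uB ≤ 1)
    (hXB0 : 0 ≤ FB - (1 - a * uB)) (hXB : FB - (1 - a * uB) < a * uB)
    (hu0 : ∀ k, 0 ≤ a * u k)
    (hu : ∀ k, u (k + 1) = u k + uB - 3 * u k * uB)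
    (hF : ∀ k, F (k + 1) = F k * FB + a * (3 - a) * u k * uB) :
    ∀ k, F k - (1 - a * u k) ≤
      max (F 0 - (1 - a * u 0)) ((FB - (1 - a * uB)) / (a * uB - (FB - (1 - a * uB)))) := by
  set XB := FB - (1 - a * uB) with hXBdef
  set Bd := max (F 0 - (1 - a * u 0)) (XB / (a * uB - XB)) with hBd
  have hden : 0 < a * uB - XB := by linarith
  have hstar : XB / (a * uB - XB) ≤ Bd := le_max_right _ _
  have hBd0 : 0 ≤ XB / (a * uB - XB) := div_nonneg hXB0 hden.le
  -- the fixed-point inequality `Bd·(1 − a uB + XB) + XB ≤ Bd`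
  have hfix : Bd * (1 - a * uB + XB) + XB ≤ Bd := by
    have h1 : XB ≤ Bd * (a * uB - XB) := by
      have := mul_le_mul_of_nonneg_right hstar hden.le
      rwa [div_mul_cancel₀ _ hden.ne'] at this
    nlinarith
  intro k
  induction k with
  | zero => exact le_max_left _ _
  | succ k ih =>
    have hstep : F (k + 1) - (1 - a * u (k + 1)) =
        (F k - (1 - a * u k)) * (1 - a * uB) + XB * (1 - a * u k) + (F k - (1 - a * u k)) * XB := by
      rw [hF k, hu k, hXBdef]
      have := deviation_linear_step a (u k) uB (F k - (1 - a * u k)) (FB - (1 - a * uB))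
      rw [show 1 - a * u k + (F k - (1 - a * u k)) = F k by ring,
        show 1 - a * uB + (FB - (1 - a * uB)) = FB by ring] at this
      exact this
    rw [hstep]
    have hcoef : 0 ≤ 1 - a * uB + XB := by linarith
    have h1 : (F k - (1 - a * u k)) * (1 - a * uB) + (F k - (1 - a * u k)) * XB =
        (F k - (1 - a * u k)) * (1 - a * uB + XB) := by ring
    have h2 : (F k - (1 - a * u k)) * (1 - a * uB + XB) ≤ Bd * (1 - a * uB + XB) :=
      mul_le_mul_of_nonneg_right ih hcoef
    have h3 : XB * (1 - a * u k) ≤ XB := by nlinarith [hu0 k]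
    linarith

end Summit.MatrixMultiplication.MatrixMultiplication.Theorems.FarEdgeDescentDialLinearTower

end
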